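import Literature.MathematicalPhysics.QuantumLattice.SectorisedIncrementBoundDBPlateau
import Literature.MathematicalPhysics.QuantumLattice.SectorisedEffectiveActionBoundWeightedPlateau
import Literature.MathematicalPhysics.QuantumLattice.GrassmannWeightedEffectiveActionGradedTruncationDB
import HarnessLib

/-!
# The orders `≥ 2` of the sectorised single-scale INCREMENT in GRADED form, DECAY-WEIGHTED (tree weights on the leg positions),
# plateau transport

Topic `MathematicalPhysics/QuantumLattice`; the weighted twin of `SectorisedIncrementBoundGradedPlateau`: the GRADED abstract step of
`GrassmannWeightedEffectiveActionGradedTruncationDB` (`sum_wt_norm_kernel_effAction_sub_gaussConv_le_graded_of_gramBounded`: orders `2 ≤ n < N₀`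
of `effAction C V − e^{Δ_C} V` in product form with the leg constraint, a tree weight `wt` on the OUTPUT label set, weighted input profile,
WEIGHTED row/column sums of the covariance) read through a substitution `f` (auxiliary sector fields at positions `π′`, pulled-back covariance
`C′ = fᵀ C f`) and an analysis map `g` (output labels at positions `π″`, weighted Young costs `(cr, cc)` of
`GrassmannWeightedKernelYoung.sum_filter_wt_norm_kernel_map_le`), and transported to the Hubbard torus by the plateau identities and the weighted
preimage bookkeeping of `SectorisedEffectiveActionBoundWeightedPlateau` (Benfatto–Giuliani–Mastropietro 2006 (2.61)–(2.63), (2.66), (2.77)–(2.83) with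
the decay bookkeeping of §3 (3.2)–(3.8): the tree expansion's kernels carry the weights at no cost in the exponents).  Cell gate-hubbard-kl, K3 engine
child, clause (E1): the hypothesis `(Hstep)` of the blocked tower in the WEIGHTED model currency of `KernelNormsWt4` (`klWtPinnedSum`: the
`klScaleWt`-weighted pinned sums of `kernel (map (toLin' E_j) 𝒱)`), orders `≥ 2`:

* §1 (generic label sets) **`sum_wt_norm_kernel_map_effAction_sub_gaussConv_le_graded_of_gramBounded`** — one output leg pinned, output positions
  weighted: `Σ_{X″_p = w″} wt(π″X″)·‖kernel_{m+1}(map g (effAction C V − e^{Δ_C}V))(X″)‖ ≤ cr·cc^m·[Σ_{n=2}^{N₀−1} ρ^{-(m+1)}κ^{-2(n−1)}α^{n−1}eⁿ·S_n(m+1; N) + tail]`,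
  `N(m′)` = the `wt∘π′`-weighted pinned sums of `kernel_{2m′} Ṽ`;
* §2 (Hubbard torus) **`sum_wt_norm_sectorAnalysis_effAction_sub_gaussConv_le_graded_of_plateau`** — thin/fat input families `F, F̃`, output family
  `F′`, plateau of `F` over `supp C` and `supp F′`, even `G` without constant part, sectorised covariance `S(F̃)ᵀ C S(F̃)` replica-Gram-bounded (`κ`)
  with WEIGHTED row/column sums `≤ α`, weighted input sizes `Σ_{Y_j = w} wt(πY)·‖kernel (map (toLin' E(F)) G) (2m′) Y‖ ≤ B m′` (THE ENGINE'S CURRENCY),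
  weighted overlap costs `(cr, cc)`; then in every degree `m+1`, one output leg pinned,
  `Σ_{X″_p = w″} wt(π″X″)·‖kernel (map (toLin' E(F′)) (effAction C G − e^{Δ_C} G)) (m+1) X″‖ ≤ cr·cc^m·[graded + tail](m′ ↦ ε_x^{2m′} B m′)`.

Everything is proved; no definition, no named fact.  NOT here: the first order (binomial–Gram; weighted twin of
`hubbardSectorKernelNorm_gaussConv_sub_le_binomial_…_of_plateau` = `GrassmannWeightedGaussConvBinomialGramPrescribed` at `J = ∅` + the same transport)
and every model constant (`κ, α, cr, cc` of the block covariance: the engine lanes' Gram/decay/overlap rows).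

## Sources

G. Benfatto, A. Giuliani, V. Mastropietro, Ann. Henri Poincaré 7 (2006) 809–898, (2.61)–(2.63), (2.66), (2.70)–(2.71a), (2.76)–(2.83), §3 (3.2)–(3.8)
[`BenfattoGiulianiMastropietro2006`]; W. de Siqueira Pedra, M. Salmhofer, Comm. Math. Phys. 282 (2008) 797–818, Thm 1.3 [`PedraSalmhofer2008`];
K. Gawȩdzki, A. Kupiainen, Comm. Math. Phys. 102 (1985) 1–30, §3 [`GawedzkiKupiainen1985GrossNeveu`].
-/

noncomputable section

namespace Literature.MathematicalPhysics.QuantumLattice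

open GrassmannAlgebra Finset Literature.Probability.LatticeModels Literature.Probability.LatticeModels.BattleFederbush
open scoped Nat

universe u

/-! ### §1 Generic label sets: the weighted graded orders `≥ 2` of the increment read through `(f, g)` -/

section Generic

variable {𝕜 : Type*} [RCLike 𝕜] {Γ Γ' Γ'' : Type u} {Λ : Type*} [Fintype Γ] [DecidableEq Γ] [Fintype Γ'] [DecidableEq Γ']
  [Fintype Γ''] [DecidableEq Γ''] [DecidableEq Λ] {wt : Finset Λ → ℝ}

omit [Fintype Γ'] in
/-- The pair weight pulled back along a position map: `wt ({X, Y}.image π′) = wt {π′ X, π′ Y}`. [folklore] -/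
private theorem wt_image_pair (π' : Γ' → Λ) (X Y : Γ') : wt (({X, Y} : Finset Γ').image π') = wt {π' X, π' Y} := by
  rw [image_insert, image_singleton]

/-- **Orders `≥ 2` of the increment, read through `(f, g)`, GRADED and DECAY-WEIGHTED** (BGM 2006 (2.61)–(2.63), (2.66), (2.77)–(2.83), §3 (3.2)–(3.8)).
Data: a tree weight `wt` on `Finset Λ`, positions `π′ : Γ′ → Λ` (auxiliary fields) and `π″ : Γ″ → Λ` (output labels); `Ṽ` even without constant part with
`wt`-weighted pinned sums `Σ_{Y_j = w} ‖kernel_{2m′} Ṽ (Y)‖·wt(π′Y) ≤ N(m′)`; `C′ = fᵀ C f` replica-Gram-bounded (`κ > 0`) with weighted row/column sums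
`Σ ‖C′(X,Y)‖·wt{π′X, π′Y} ≤ α`; `θ = eα‖Ṽ‖_h/κ² < 1`; weighted costs `(cr, cc)` of the matrix of `g ∘ f`; `N₀ ≥ 2`.  Then in every degree `m + 1`, one output
leg pinned at `w″`,
`Σ_{X″_p = w″} wt(π″X″)·‖kernel_{m+1} (map g (effAction C (map f Ṽ) − e^{Δ_C}(map f Ṽ)))(X″)‖ ≤ cr·cc^m·[Σ_{n=2}^{N₀−1} ρ^{-(m+1)}κ^{-2(n−1)}α^{n−1}eⁿ S_n(m+1; N) + ρ^{-(m+1)} e‖Ṽ‖_h θ^{N₀−1}/(1−θ)]`.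
[cite: BenfattoGiulianiMastropietro2006, (2.61)-(2.63), (2.66), (2.83), (3.2)-(3.8)] -/
theorem sum_wt_norm_kernel_map_effAction_sub_gaussConv_le_graded_of_gramBounded (hwt : IsTreeWeight wt) (π' : Γ' → Λ) (π'' : Γ'' → Λ)
    (C : Matrix Γ Γ 𝕜) (f : (Γ' → 𝕜) →ₗ[𝕜] (Γ → 𝕜)) (g : (Γ → 𝕜) →ₗ[𝕜] (Γ'' → 𝕜))
    (Vt : GrassmannAlgebra 𝕜 Γ') (hVt : Vt ∈ evenPart 𝕜 Γ') (hVt0 : constPart 𝕜 Vt = 0)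
    {κ : ℝ} (hκ : 0 < κ) (hGB : IsGramBoundedR ((LinearMap.toMatrix' f).transpose * C * LinearMap.toMatrix' f) κ)
    (N : ℕ → ℝ) (hN0 : ∀ m', 0 ≤ N m')
    (hN : ∀ (m' : ℕ) (j : Fin (2 * m')) (w : Γ'), ∑ Y ∈ univ.filter (fun Y : Fin (2 * m') → Γ' => Y j = w),
      ‖kernel 𝕜 Vt (2 * m') Y‖ * wt ((univ.image Y).image π') ≤ N m')
    {α : ℝ} (hα : 0 < α)
    (hrow : ∀ X, ∑ Y, ‖((LinearMap.toMatrix' f).transpose * C * LinearMap.toMatrix' f) X Y‖ * wt {π' X, π' Y} ≤ α)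
    (hcol : ∀ Y, ∑ X, ‖((LinearMap.toMatrix' f).transpose * C * LinearMap.toMatrix' f) X Y‖ * wt {π' X, π' Y} ≤ α)
    {ρ : ℝ} (hρ : 0 < ρ) (hθ : Real.exp 1 * α * normV Γ' κ ρ N / κ ^ 2 < 1)
    {cr cc : ℝ} (hcc0 : 0 ≤ cc)
    (hrow' : ∀ X'', ∑ X', ‖(LinearMap.toMatrix' g * LinearMap.toMatrix' f) X'' X'‖ * wt {π'' X'', π' X'} ≤ cr)
    (hcol' : ∀ X', ∑ X'', ‖(LinearMap.toMatrix' g * LinearMap.toMatrix' f) X'' X'‖ * wt {π'' X'', π' X'} ≤ cc)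
    {N₀ : ℕ} (hN₀ : 2 ≤ N₀) (m : ℕ) (p : Fin (m + 1)) (w'' : Γ'') :
    ∑ X'' ∈ univ.filter (fun X'' : Fin (m + 1) → Γ'' => X'' p = w''), wt ((univ.image X'').image π'') *
        ‖kernel 𝕜 (ExteriorAlgebra.map g
          (effAction 𝕜 C (ExteriorAlgebra.map f Vt) - gaussConv 𝕜 C (ExteriorAlgebra.map f Vt))) (m + 1) X''‖ ≤
      cr * cc ^ m *
        (∑ n ∈ Ico 2 N₀, (ρ⁻¹ ^ (m + 1) * κ⁻¹ ^ (2 * (n - 1)) * (α ^ (n - 1) * Real.exp n)) *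
            ∑ δ ∈ (Fintype.piFinset fun _ : Fin n => range (Fintype.card Γ' / 2 + 1)) with m + 1 + 2 * (n - 1) ≤ ∑ a, 2 * δ a,
              ∏ a, (Real.exp 2 * (κ + ρ)) ^ (2 * δ a) * N (δ a) +
          ρ⁻¹ ^ (m + 1) * (Real.exp 1 * normV Γ' κ ρ N) * (Real.exp 1 * α * normV Γ' κ ρ N / κ ^ 2) ^ (N₀ - 1) /
            (1 - Real.exp 1 * α * normV Γ' κ ρ N / κ ^ 2)) := by
  set C' : Matrix Γ' Γ' 𝕜 := (LinearMap.toMatrix' f).transpose * C * LinearMap.toMatrix' f with hC'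
  -- the weight pulled back to the auxiliary labels is a tree weight
  set wt' : Finset Γ' → ℝ := fun S => wt (S.image π') with hwt'
  have hwt'tree : IsTreeWeight wt' := hwt.comap π'
  have hrow₁ : ∀ X, ∑ Y, ‖C' X Y‖ * wt' {X, Y} ≤ α := fun X => by
    simpa only [hwt', wt_image_pair] using hrow X
  have hcol₁ : ∀ Y, ∑ X, ‖C' X Y‖ * wt' {X, Y} ≤ α := fun Y => by
    simpa only [hwt', wt_image_pair] using hcol Y
  -- the weighted graded abstract bound in the auxiliary representation
  have hnV0 : 0 ≤ normV Γ' κ ρ N := normV_nonneg hκ.le hρ.le hN0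
  have hθ0 : 0 ≤ Real.exp 1 * α * normV Γ' κ ρ N / κ ^ 2 := by positivity
  set B : ℝ := ∑ n ∈ Ico 2 N₀, (ρ⁻¹ ^ (m + 1) * κ⁻¹ ^ (2 * (n - 1)) * (α ^ (n - 1) * Real.exp n)) *
      ∑ δ ∈ (Fintype.piFinset fun _ : Fin n => range (Fintype.card Γ' / 2 + 1)) with m + 1 + 2 * (n - 1) ≤ ∑ a, 2 * δ a,
        ∏ a, (Real.exp 2 * (κ + ρ)) ^ (2 * δ a) * N (δ a) +
    ρ⁻¹ ^ (m + 1) * (Real.exp 1 * normV Γ' κ ρ N) * (Real.exp 1 * α * normV Γ' κ ρ N / κ ^ 2) ^ (N₀ - 1) /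
      (1 - Real.exp 1 * α * normV Γ' κ ρ N / κ ^ 2) with hB
  have hB0 : 0 ≤ B := by
    refine add_nonneg (sum_nonneg fun n _ => mul_nonneg (by positivity) (sum_nonneg fun δ _ => prod_nonneg fun a _ => ?_))
      (div_nonneg (by positivity) (by linarith))
    exact mul_nonneg (by positivity) (hN0 _)
  have hgraded : ∀ (q : Fin (m + 1)) (x : Γ'), ∑ X ∈ univ.filter (fun X : Fin (m + 1) → Γ' => X q = x),
      ‖kernel 𝕜 (effAction 𝕜 C' Vt - gaussConv 𝕜 C' Vt) (m + 1) X‖ * wt ((univ.image X).image π') ≤ B := by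
    intro q x
    have h := sum_wt_norm_kernel_effAction_sub_gaussConv_le_graded_of_gramBounded C' hwt'tree hκ hGB Vt hVt hVt0 N hN0 hN hα
      hrow₁ hcol₁ hρ hθ hN₀ (Nat.succ_pos m) q x
    refine le_of_eq_of_le (sum_congr rfl fun X _ => mul_comm _ _) h
  -- read through `g ∘ f` by the weighted Young inequality
  have hsub : effAction 𝕜 C (ExteriorAlgebra.map f Vt) - gaussConv 𝕜 C (ExteriorAlgebra.map f Vt) =
      ExteriorAlgebra.map f (effAction 𝕜 C' Vt - gaussConv 𝕜 C' Vt) := by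
    rw [effAction_map, gaussConv_map, map_sub]
  rw [hsub, map_map_eq_map_comp]
  exact sum_filter_wt_norm_kernel_map_le hwt π' π'' (g ∘ₗ f) hcc0
    (by intro X''; rw [LinearMap.toMatrix'_comp]; exact hrow' X'')
    (by intro X'; simp only [LinearMap.toMatrix'_comp]; exact hcol' X') (effAction 𝕜 C' Vt - gaussConv 𝕜 C' Vt) m hB0 hgraded p w''

end Generic

/-! ### §2 The Hubbard torus: plateau transfer in the engine's weighted currency -/

section Transfer

variable {L M : ℕ} [NeZero L] [NeZero M] {N N' : ℕ} {Λ : Type*} [DecidableEq Λ] {wt : Finset Λ → ℝ}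

/-- **The orders `≥ 2` of the increment of the sectorised kernels across one slice, GRADED and DECAY-WEIGHTED** (BGM 2006 (2.61)–(2.63), (2.66),
(2.77)–(2.83), §3 (3.2)–(3.8)).  Data: a tree weight `wt` on `Finset Λ`, position maps `π` (input sector-field labels) and `π″` (output labels); thin/fat input
families `F, F̃` (`F̃F = F`, `ΣF = 0 ⇒ F = 0`), output family `F′`, plateau of `F` over `supp C` and over `F′`; even `G` without constant part; the sectorised
covariance `C′ = S(F̃)ᵀ C S(F̃)` replica-Gram-bounded (`κ > 0`) with WEIGHTED row/column sums `Σ‖C′(X,Y)‖·wt{πX, πY} ≤ α`; WEIGHTED input sizes in the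
engine's currency `Σ_{Y_j = w} wt(πY)·‖kernel (map (toLin' E(F)) G) (2m′) Y‖ ≤ B m′`; radius `ρ`, `θ = eα‖Ṽ‖_h/κ² < 1` with `‖Ṽ‖_h = normV κ ρ (m′ ↦ ε_x^{2m′} B m′)`;
weighted overlap costs `(cr, cc)` of `E(F′)S(F̃)`; `N₀ ≥ 2`.  Then in every degree `m + 1`, one output leg pinned at `w″`,
`Σ_{X″_p = w″} wt(π″X″)·‖kernel (map (toLin' E(F′)) (effAction C G − e^{Δ_C} G)) (m+1) X″‖ ≤ cr·cc^m·[Σ_{n=2}^{N₀−1} ρ^{-(m+1)}κ^{-2(n−1)}α^{n−1}eⁿ S_n(m+1) + tail]`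
with the profile `m′ ↦ ε_x^{2m′} B m′`. [cite: BenfattoGiulianiMastropietro2006, (2.61)-(2.63), (2.66), (2.83), (3.2)-(3.8)] -/
theorem sum_wt_norm_sectorAnalysis_effAction_sub_gaussConv_le_graded_of_plateau
    (hwt : IsTreeWeight wt) (π : SpaceTimeIdx L M × SectorLeg N → Λ) (π'' : SpaceTimeIdx L M × SectorLeg N' → Λ)
    {β : ℝ} (hβ : 0 < β) (F Ft : Fin N → FreqMomentum L M → ℂ) (hFF : ∀ ω k, Ft ω k * F ω k = F ω k)
    (hF0 : ∀ k, ∑ ω, F ω k = 0 → ∀ ω, F ω k = 0)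
    (F' : Fin N' → FreqMomentum L M → ℂ) (G : HubbardGrassmann L M) (hG : G ∈ evenPart ℂ (HubbardFieldIdx L M))
    (hG0 : constPart ℂ G = 0)
    (C : Matrix (HubbardFieldIdx L M) (HubbardFieldIdx L M) ℂ)
    (hCpl : ∀ X Y, C X Y ≠ 0 → ∑ ω, F ω X.1.1 = 1 ∧ ∑ ω, F ω Y.1.1 = 1)
    (hF'pl : ∀ (ω' : Fin N') (k : FreqMomentum L M), F' ω' k ≠ 0 → ∑ ω, F ω k = 1)
    {κ : ℝ} (hκ : 0 < κ)
    (hGB : IsGramBoundedR ((sectorSubMatrix L M β Ft).transpose * C * sectorSubMatrix L M β Ft) κ)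
    (B : ℕ → ℝ) (hB0 : ∀ m', 0 ≤ B m')
    (hB : ∀ (m' : ℕ) (j : Fin (2 * m')) (w : SpaceTimeIdx L M × SectorLeg N),
      ∑ Y ∈ univ.filter (fun Y : Fin (2 * m') → SpaceTimeIdx L M × SectorLeg N => Y j = w),
        wt ((univ.image Y).image π) * ‖kernel ℂ (ExteriorAlgebra.map (Matrix.toLin' (sectorAnalysisMatrix L M β F)) G) (2 * m') Y‖ ≤
          B m')
    {α : ℝ} (hα : 0 < α)
    (hrow : ∀ X, ∑ Y, ‖((sectorSubMatrix L M β Ft).transpose * C * sectorSubMatrix L M β Ft) X Y‖ * wt {π X, π Y} ≤ α)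
    (hcol : ∀ Y, ∑ X, ‖((sectorSubMatrix L M β Ft).transpose * C * sectorSubMatrix L M β Ft) X Y‖ * wt {π X, π Y} ≤ α)
    {ρ : ℝ} (hρ : 0 < ρ)
    (hθ : Real.exp 1 * α * normV (SpaceTimeIdx L M × SectorLeg N) κ ρ (fun m' => imagTimeWeight β M ^ (2 * m') * B m') / κ ^ 2 < 1)
    {cr cc : ℝ} (hcc0 : 0 ≤ cc)
    (hrow' : ∀ X'', ∑ X', ‖(sectorAnalysisMatrix L M β F' * sectorSubMatrix L M β Ft) X'' X'‖ * wt {π'' X'', π X'} ≤ cr)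
    (hcol' : ∀ X', ∑ X'', ‖(sectorAnalysisMatrix L M β F' * sectorSubMatrix L M β Ft) X'' X'‖ * wt {π'' X'', π X'} ≤ cc)
    {N₀ : ℕ} (hN₀ : 2 ≤ N₀) (m : ℕ) (p : Fin (m + 1)) (w'' : SpaceTimeIdx L M × SectorLeg N') :
    ∑ X'' ∈ univ.filter (fun X'' : Fin (m + 1) → SpaceTimeIdx L M × SectorLeg N' => X'' p = w''),
        wt ((univ.image X'').image π'') *
          ‖kernel ℂ (ExteriorAlgebra.map (Matrix.toLin' (sectorAnalysisMatrix L M β F')) (effAction ℂ C G - gaussConv ℂ C G))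
            (m + 1) X''‖ ≤
      cr * cc ^ m *
        (∑ n ∈ Ico 2 N₀, (ρ⁻¹ ^ (m + 1) * κ⁻¹ ^ (2 * (n - 1)) * (α ^ (n - 1) * Real.exp n)) *
            ∑ δ ∈ (Fintype.piFinset fun _ : Fin n => range (Fintype.card (SpaceTimeIdx L M × SectorLeg N) / 2 + 1)) with
                m + 1 + 2 * (n - 1) ≤ ∑ a, 2 * δ a,
              ∏ a, (Real.exp 2 * (κ + ρ)) ^ (2 * δ a) * (imagTimeWeight β M ^ (2 * δ a) * B (δ a)) +
          ρ⁻¹ ^ (m + 1) * (Real.exp 1 * normV (SpaceTimeIdx L M × SectorLeg N) κ ρ (fun m' => imagTimeWeight β M ^ (2 * m') * B m')) *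
            (Real.exp 1 * α * normV (SpaceTimeIdx L M × SectorLeg N) κ ρ (fun m' => imagTimeWeight β M ^ (2 * m') * B m') / κ ^ 2) ^
              (N₀ - 1) /
            (1 - Real.exp 1 * α * normV (SpaceTimeIdx L M × SectorLeg N) κ ρ (fun m' => imagTimeWeight β M ^ (2 * m') * B m') / κ ^ 2)) := by
  have hε : 0 ≤ imagTimeWeight β M := imagTimeWeight_nonneg hβ.le M
  -- the weighted pinned sums of the preimage's kernels, in the engine's currency
  have hwl : ∀ S : Finset (SpaceTimeIdx L M × SectorLeg N), 0 ≤ wt (S.image π) := fun S => zero_le_one.trans (hwt.one_le _)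
  have hN : ∀ (m' : ℕ) (j : Fin (2 * m')) (w : SpaceTimeIdx L M × SectorLeg N),
      ∑ Y ∈ univ.filter (fun Y : Fin (2 * m') → SpaceTimeIdx L M × SectorLeg N => Y j = w),
        ‖kernel ℂ (sectorPreimage β F G) (2 * m') Y‖ * wt ((univ.image Y).image π) ≤ imagTimeWeight β M ^ (2 * m') * B m' :=
    fun m' j w => sum_wt_norm_kernel_sectorPreimage_le hβ.le F G (fun S => wt (S.image π)) hwl (hB0 m') (hB m') j w
  have hN0 : ∀ m', 0 ≤ imagTimeWeight β M ^ (2 * m') * B m' := fun m' => mul_nonneg (pow_nonneg hε _) (hB0 m')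
  -- transfer from `map S Ṽ` to `G` (plateau identities)
  have hea := map_sectorAnalysis_effAction_map_sectorPreimage_of_plateau hβ.ne' F Ft hFF hF0 F' G C hCpl hF'pl
  have hgc := map_sectorAnalysis_gaussConv_map_sectorPreimage_of_plateau hβ.ne' F Ft hFF hF0 F' G C hCpl hF'pl
  have hrepl : ExteriorAlgebra.map (Matrix.toLin' (sectorAnalysisMatrix L M β F')) (effAction ℂ C G - gaussConv ℂ C G) =
      ExteriorAlgebra.map (Matrix.toLin' (sectorAnalysisMatrix L M β F'))
        (effAction ℂ C (ExteriorAlgebra.map (Matrix.toLin' (sectorSubMatrix L M β Ft)) (sectorPreimage β F G)) -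
          gaussConv ℂ C (ExteriorAlgebra.map (Matrix.toLin' (sectorSubMatrix L M β Ft)) (sectorPreimage β F G))) := by
    rw [map_sub, map_sub, hea, hgc]
  rw [hrepl]
  -- the weighted graded step for `Ṽ` in the representation `(S, E)`
  exact sum_wt_norm_kernel_map_effAction_sub_gaussConv_le_graded_of_gramBounded hwt π π'' C
    (Matrix.toLin' (sectorSubMatrix L M β Ft)) (Matrix.toLin' (sectorAnalysisMatrix L M β F')) (sectorPreimage β F G)
    (sectorPreimage_mem_evenPart β F hG) (by rw [constPart_sectorPreimage, hG0]) hκ (by simpa only [LinearMap.toMatrix'_toLin'] using hGB)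
    (fun m' => imagTimeWeight β M ^ (2 * m') * B m') hN0 hN hα (by simpa only [LinearMap.toMatrix'_toLin'] using hrow)
    (by simpa only [LinearMap.toMatrix'_toLin'] using hcol) hρ hθ hcc0 (by simpa only [LinearMap.toMatrix'_toLin'] using hrow')
    (by simpa only [LinearMap.toMatrix'_toLin'] using hcol') hN₀ m p w''

end Transfer

end Literature.MathematicalPhysics.QuantumLattice

end
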